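import Mathlib
import HarnessLib
import Summits.HubbardSuperconductivity.HubbardSuperconductivity.Theorems.KLProgrammeKLRegimeCountertermV7Volume
import Summits.HubbardSuperconductivity.HubbardSuperconductivity.Theorems.KLProgrammeKLRegimeSplitBundleV10

/-!
# Route `KLProgramme` — the COUNTERTERM child of the gen-3 K3 resplit, `CountertermP2 klPredsV10 klWindowC` (route decl `KLRegimeCountertermV10`
# once filed; gen-2 item stmt-HubbardSuperconductivity-19664 `KLRegimeCountertermV7`): REDUCTION TO THE ONE-VOLUME CONSTRUCTION at the V10 bundle —
# the volume transfer by (E3f) PROVED (crux K3 stmt-HubbardSuperconductivity-19937; seat hubbard-kl-k3c5-p1 g2, for the p2 lineage)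

This module is the `klPredsV10` twin of `KLProgrammeKLRegimeCountertermV7Volume` (p451758, seat p2 g4).  Between V7 and V10 the bundle gained the
Δ16 count repair (`legSliceCountT`, V8), the Δ18 angular-regularity conjunct (E3g) `TwoLegAngularG` in the two-leg slot (V9) and the Δ-UV (Δ19)
scale-`0` tolerances of the engine slot (`EngineBoundsAtV7S`, V10); child 2's renormalisation package `ctRen G` and tolerance `ctCr G` are
unchanged and imported.  What changes for child 2 is bookkeeping only:

* the hypothesis block `CtHypV10` reads the V10 slots (`EngineBoundsAtV7S`, `TwoLegStepV10`, `BetaSplitAtS2`);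
* the (E3f) comparison-volume antecedent of `TwoLegStepV10` is `histV10 ∧ TwoLegStepG histV10 ∧ TwoLegAngularG` below `n` at `(L′, M′)` — one
  conjunct more than V7's, supplied at the target volume by the same hypothesis block (`TwoLegStepV10` there carries (E3g) as its second conjunct);
* the one-volume construction `CtOneVolumeV10` is `CtOneVolume` verbatim on `CtHypV10` (its conclusion — the local parts at ONE volume `(L₀, M₀)` within
  HALF the quadratic tolerance at EVERY real angle — is now certifiable from the block: (E3g) bounds `θ ↦ ν_n(K)(θ)` between the lattice angles,
  Δ18 / k3c3-p3's `TwoLegAngularG.abs_le_of_net`, p1b's five-step route HOME/STATUS 2026-08-26T17:49:35Z).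

PROVED here: the volume transfer `ct_volumeTransferV10` (strong induction on the scale at the target volume, as in V7) and the composition
`countertermP2_klPredsV10_of : (∀ G P Q, G.WF → P.WF → Q.WF → CtOneVolumeV10 G P Q) → CountertermP2 klPredsV10 klWindowC` — so the gen-3 counterterm
child closes from ONE registered stub, `stub_ct_oneVolume : CtOneVolumeV10 G P Q`.  Two definitions (the V10 hypothesis block and the V10 one-volume
statement) + proofs; nothing is asserted about the model.
-/

noncomputable section

namespace Summit.HubbardSuperconductivity.HubbardSuperconductivity.Theorems.KLRegimeSplit

set_option linter.dupNamespace false -- summit = problem name (single-conjunct summit), D-0017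

open Real Finset Literature.MathematicalPhysics.QuantumLattice Literature.Probability.LatticeModels
open Summit.HubbardSuperconductivity.HubbardSuperconductivity.Theorems.KLProgrammeLegKernels

section Model

/-- **Child 2's hypothesis block at the V10 bundle** at `(G, P, Q, β, U, μ)` beyond thresholds `(Lh, Mh)`: every admissible frame (for child 2's
package `ctRen G`), at every large volume and every scale, renormalised below the scale ⇒ the V10 engine output `EngineBoundsAtV7S`, the V10
two-leg step `TwoLegStepV10` (incl. (E3g) and the (E3f) rate) and the split `BetaSplitAtS2` at the scale. -/
def CtHypV10 (G : GeoConsts) (P : SplitConsts) (Q : EngConsts) (β U μ : ℝ) (Lh : ℕ) (Mh : ℕ → ℕ) : Prop :=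
  ∀ K : TrigPolyC4v, FrameOK (ctRen G) U (nScales β) μ K →
    ∀ (L M : ℕ) [NeZero L] [NeZero M], Lh ≤ L → Mh L ≤ M →
      ∀ n : ℕ, n ≤ nScales β → (∀ j < n, RenormalisedAtF L M β U μ K (ctRen G) j) →
        EngineBoundsAtV7S L M G P Q β U μ K n ∧ TwoLegStepV10 L M G P Q (ctRen G) β U μ K n ∧ BetaSplitAtS2 L M G P Q β U μ K n

end Model

/-- **The ONE-VOLUME CONSTRUCTION at the V10 bundle** (the one stub of the gen-3 counterterm child; `CtOneVolume` verbatim on `CtHypV10`).  For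
the constants `(G, P, Q)`: there are `c₁, U₀` such that, in the regime, from the V10 hypothesis block beyond `(Lh, Mh)` one builds at ONE volume
`(L₀, M₀) ≥ (Lh, Mh L₀)`, `M₀ ≥ Q.M0 β L₀`, an ADMISSIBLE frame `K` whose local parts at `(L₀, M₀)` are within HALF the quadratic tolerance at every
scale and every real angle, with `L₀` so large that the volume rate `Q.CL β n / L₀` fits in the other half. -/
def CtOneVolumeV10 (G : GeoConsts) (P : SplitConsts) (Q : EngConsts) : Prop :=
    ∃ c₁ : ℝ, 0 < c₁ ∧ ∀ c : ℝ, 0 < c → c ≤ c₁ → ∃ U₀ : ℝ, 0 < U₀ ∧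
      ∀ μ ∈ klWindowC, ∀ U : ℝ, 0 < U → U ≤ U₀ → ∀ β : ℝ, klBetaMin ≤ β → β ≤ Real.exp (c / U ^ 2) →
        ∀ (Lh : ℕ) (Mh : ℕ → ℕ), CtHypV10 G P Q β U μ Lh Mh →
          ∃ K : TrigPolyC4v, FrameOK (ctRen G) U (nScales β) μ K ∧
            ∃ (L₀ M₀ : ℕ), 0 < L₀ ∧ 0 < M₀ ∧ Lh ≤ L₀ ∧ Mh L₀ ≤ M₀ ∧ Q.M0 β L₀ ≤ M₀ ∧
              (∀ (_ : NeZero L₀) (_ : NeZero M₀), ∀ n : ℕ, n ≤ nScales β →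
                (∀ θ : ℝ, |klLocalPart L₀ M₀ β U μ K n θ| ≤ ctCr G * |U| * klScale klE0 n ^ 2 / klE0 / 2) ∧
                Q.CL β n / L₀ ≤ ctCr G * |U| * klScale klE0 n ^ 2 / klE0 / 2)

/-- **VOLUME TRANSFER at the V10 bundle (PROVED).**  From the one-volume frame and the V10 hypothesis block: at every volume `(L, M)` with
`L₀ ≤ L`, `max (Mh L) (Q.M0 β L) ≤ M`, upward (strong) induction on `n` — the renormalisation of `K` at `(L, M)` below `n` gives, through the block,
the V10 history `histV10 ∧ TwoLegStepG histV10 ∧ TwoLegAngularG` there below `n`, which is the (E3f) antecedent of `TwoLegStepV10` at the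
construction volume `(L₀, M₀)`; so `|ν_n^{L,M}| ≤ ½tol + Q.CL β n / L₀ ≤ tol`. -/
theorem ct_volumeTransferV10 (G : GeoConsts) (P : SplitConsts) (Q : EngConsts) (hG : G.WF) {β U μ : ℝ} {Lh : ℕ} {Mh : ℕ → ℕ}
    (hyp : CtHypV10 G P Q β U μ Lh Mh) {K : TrigPolyC4v} (hK : FrameOK (ctRen G) U (nScales β) μ K) {L₀ M₀ : ℕ} [NeZero L₀] [NeZero M₀]
    (hL₀ : Lh ≤ L₀) (hM₀ : Mh L₀ ≤ M₀) (hM₀' : Q.M0 β L₀ ≤ M₀)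
    (hhalf : ∀ n : ℕ, n ≤ nScales β →
      (∀ θ : ℝ, |klLocalPart L₀ M₀ β U μ K n θ| ≤ ctCr G * |U| * klScale klE0 n ^ 2 / klE0 / 2) ∧
      Q.CL β n / L₀ ≤ ctCr G * |U| * klScale klE0 n ^ 2 / klE0 / 2) :
    ∀ (L M : ℕ) [NeZero L] [NeZero M], L₀ ≤ L → max (Mh L) (Q.M0 β L) ≤ M →
      ∀ n : ℕ, n ≤ nScales β → RenormalisedAtF L M β U μ K (ctRen G) n := by
  -- the half tolerance is nonnegative
  have htol_nonneg : ∀ n, 0 ≤ ctCr G * |U| * klScale klE0 n ^ 2 / klE0 / 2 := by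
    intro n
    have hS : ∀ j, 0 ≤ G.S j := hG.2.2.2.2.2.2.2.2.2.2.2.2.2.2.2.2.2.1
    have hcr : 0 ≤ ctCr G := by unfold ctCr; nlinarith [hS 0]
    have he0 : (0:ℝ) < klE0 := by norm_num [klE0]
    positivity
  -- renormalisation at the construction volume, at every scale (half tolerance ≤ tolerance)
  have hren0 : ∀ n, n ≤ nScales β → RenormalisedAtF L₀ M₀ β U μ K (ctRen G) n := by
    intro n hn θ
    have h := (hhalf n hn).1 θ
    show |klLocalPart L₀ M₀ β U μ K n θ| ≤ ctCr G * |U| * klScale klE0 n ^ 2 / klE0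
    linarith [htol_nonneg n]
  intro L M _ _ hL hM
  have hMh : Mh L ≤ M := (le_max_left _ _).trans hM
  have hM0 : Q.M0 β L ≤ M := (le_max_right _ _).trans hM
  have hLh : Lh ≤ L := hL₀.trans hL
  -- strong induction on the scale at the target volume
  intro n
  induction n using Nat.strong_induction_on with
  | _ n ih =>
    intro hn θ
    -- history at the target volume below `n`
    have hrenL : ∀ j < n, RenormalisedAtF L M β U μ K (ctRen G) j := fun j hj =>
      ih j hj (le_of_lt (lt_of_lt_of_le hj hn))
    have hslotsL : ∀ j < n, EngineBoundsAtV7S L M G P Q β U μ K j ∧ TwoLegStepV10 L M G P Q (ctRen G) β U μ K j ∧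
        BetaSplitAtS2 L M G P Q β U μ K j := fun j hj =>
      hyp K hK L M hLh hMh j (le_of_lt (lt_of_lt_of_le hj hn)) fun i hi => hrenL i (hi.trans hj)
    have hanteL : ∀ j < n, histV10 L M G P Q (ctRen G) β U μ K j ∧
        TwoLegStepG L M (histV10 L M G P Q (ctRen G) β U μ) G P Q (ctRen G) β U μ K j ∧
          TwoLegAngularG L M G Q (ctRen G) β U μ K j := fun j hj =>
      ⟨⟨(hslotsL j hj).2.2, hrenL j hj, (hslotsL j hj).1⟩, (hslotsL j hj).2.1.1, (hslotsL j hj).2.1.2.1⟩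
    -- the two-leg step at the construction volume at scale `n`, hence its volume-rate clause
    have hstep0 : TwoLegStepV10 L₀ M₀ G P Q (ctRen G) β U μ K n :=
      (hyp K hK L₀ M₀ hL₀ hM₀ n hn fun j hj => hren0 j (le_of_lt (lt_of_lt_of_le hj hn))).2.1
    have hrate := hstep0.2.2 hM₀' L M hL hM0 hanteL θ
    have hhalfθ := (hhalf n hn).1 θ
    have hCL := (hhalf n hn).2
    show |klLocalPart L M β U μ K n θ| ≤ ctCr G * |U| * klScale klE0 n ^ 2 / klE0
    have htri : |klLocalPart L M β U μ K n θ| ≤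
        |klLocalPart L₀ M₀ β U μ K n θ| + |klLocalPart L₀ M₀ β U μ K n θ - klLocalPart L M β U μ K n θ| := by
      have h1 := abs_sub_abs_le_abs_sub (klLocalPart L M β U μ K n θ) (klLocalPart L₀ M₀ β U μ K n θ)
      rw [abs_sub_comm] at h1
      linarith
    linarith

/-- **COMPOSITION: the gen-3 counterterm child at the V10 bundle follows from the one-volume construction alone** (`CtOneVolumeV10` for all
well-formed constants) — the volume transfer is proved above; the renormalisation package is `ctRen G` (Δ8: a function of `G` alone), the
common Matsubara threshold is `Mc L = max (Mh L) (Q.M0 β L)`. -/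
theorem countertermP2_klPredsV10_of (hone : ∀ G P Q, G.WF → P.WF → Q.WF → CtOneVolumeV10 G P Q) :
    CountertermP2 klPredsV10 klWindowC := by
  intro G P hG hP
  refine ⟨ctRen G, ctRen_WF2 hG, fun Q hQ => ?_⟩
  obtain ⟨c₁, hc₁, hc⟩ := hone G P Q hG hP hQ
  refine ⟨c₁, hc₁, fun c hc0 hcc => ?_⟩
  obtain ⟨U₀, hU₀, hmain⟩ := hc c hc0 hcc
  refine ⟨U₀, hU₀, fun μ hμ U hU hUle β hβ hβc Lh Mh hhyp => ?_⟩
  have hyp : CtHypV10 G P Q β U μ Lh Mh := fun K hK L M _ _ hL hM n hn hren =>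
    hhyp K hK L M hL hM n hn hren
  obtain ⟨K, hK, L₀, M₀, hL₀pos, hM₀pos, hL₀, hM₀, hM₀', hhalf⟩ := hmain μ hμ U hU hUle β hβ hβc Lh Mh hyp
  haveI : NeZero L₀ := ⟨Nat.pos_iff_ne_zero.mp hL₀pos⟩
  haveI : NeZero M₀ := ⟨Nat.pos_iff_ne_zero.mp hM₀pos⟩
  refine ⟨K, hK, L₀, fun L => max (Mh L) (Q.M0 β L), fun L M _ _ hL hM n hn => ?_⟩
  exact ct_volumeTransferV10 G P Q hG hyp hK hL₀ hM₀ hM₀' (hhalf inferInstance inferInstance) L M hL hM n hn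

/-- **The V10 hypothesis block yields (E3g) for renormalised frames** (child 2's reading of the angular clause: for every admissible frame, at every
large volume and every scale renormalised below it, `θ ↦ ν_n(K)(θ)` is `C⁴` with the `angBar` derivative bounds) — the conjunct the one-volume
construction uses to pass from the lattice angles to every real angle. -/
theorem CtHypV10.twoLegAngularG {G : GeoConsts} {P : SplitConsts} {Q : EngConsts} {β U μ : ℝ} {Lh : ℕ} {Mh : ℕ → ℕ}
    (hyp : CtHypV10 G P Q β U μ Lh Mh) {K : TrigPolyC4v} (hK : FrameOK (ctRen G) U (nScales β) μ K) {L M : ℕ} [NeZero L] [NeZero M]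
    (hL : Lh ≤ L) (hM : Mh L ≤ M) {n : ℕ} (hn : n ≤ nScales β) (hren : ∀ j < n, RenormalisedAtF L M β U μ K (ctRen G) j) :
    TwoLegAngularG L M G Q (ctRen G) β U μ K n :=
  (hyp K hK L M hL hM n hn hren).2.1.2.1

/-- **The V10 hypothesis block yields the «G» two-leg step for renormalised frames** (sizes, floor, frame-Lipschitz at the V10 history, slopes). -/
theorem CtHypV10.twoLegStepG {G : GeoConsts} {P : SplitConsts} {Q : EngConsts} {β U μ : ℝ} {Lh : ℕ} {Mh : ℕ → ℕ}
    (hyp : CtHypV10 G P Q β U μ Lh Mh) {K : TrigPolyC4v} (hK : FrameOK (ctRen G) U (nScales β) μ K) {L M : ℕ} [NeZero L] [NeZero M]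
    (hL : Lh ≤ L) (hM : Mh L ≤ M) {n : ℕ} (hn : n ≤ nScales β) (hren : ∀ j < n, RenormalisedAtF L M β U μ K (ctRen G) j) :
    TwoLegStepG L M (histV10 L M G P Q (ctRen G) β U μ) G P Q (ctRen G) β U μ K n :=
  (hyp K hK L M hL hM n hn hren).2.1.1

/-- **The V10 hypothesis block yields the (E3f) volume rate between two volumes carrying the renormalisation history** (the form child 2's
one-volume construction and its volume transfer consume): if `K` is renormalised below `n` at `(L, M)` and at `(L′, M′)`, `L ≤ L′`, both beyond
the thresholds and the Matsubara thresholds `Q.M0`, then `|ν_n^{L,M}(θ) − ν_n^{L′,M′}(θ)| ≤ Q.CL β n / L` at every angle. -/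
theorem CtHypV10.volumeRate {G : GeoConsts} {P : SplitConsts} {Q : EngConsts} {β U μ : ℝ} {Lh : ℕ} {Mh : ℕ → ℕ}
    (hyp : CtHypV10 G P Q β U μ Lh Mh) {K : TrigPolyC4v} (hK : FrameOK (ctRen G) U (nScales β) μ K) {L M : ℕ} [NeZero L] [NeZero M]
    (hL : Lh ≤ L) (hM : Mh L ≤ M) (hM0 : Q.M0 β L ≤ M) {L' M' : ℕ} [NeZero L'] [NeZero M'] (hLL' : L ≤ L') (hM' : Mh L' ≤ M')
    (hM0' : Q.M0 β L' ≤ M') {n : ℕ} (hn : n ≤ nScales β) (hren : ∀ j < n, RenormalisedAtF L M β U μ K (ctRen G) j)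
    (hren' : ∀ j < n, RenormalisedAtF L' M' β U μ K (ctRen G) j) (θ : ℝ) :
    |klLocalPart L M β U μ K n θ - klLocalPart L' M' β U μ K n θ| ≤ Q.CL β n / L := by
  have hL' : Lh ≤ L' := hL.trans hLL'
  have hslots' : ∀ j < n, EngineBoundsAtV7S L' M' G P Q β U μ K j ∧ TwoLegStepV10 L' M' G P Q (ctRen G) β U μ K j ∧
      BetaSplitAtS2 L' M' G P Q β U μ K j := fun j hj =>
    hyp K hK L' M' hL' hM' j (le_of_lt (lt_of_lt_of_le hj hn)) fun i hi => hren' i (hi.trans hj)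
  have hante' : ∀ j < n, histV10 L' M' G P Q (ctRen G) β U μ K j ∧
      TwoLegStepG L' M' (histV10 L' M' G P Q (ctRen G) β U μ) G P Q (ctRen G) β U μ K j ∧
        TwoLegAngularG L' M' G Q (ctRen G) β U μ K j := fun j hj =>
    ⟨⟨(hslots' j hj).2.2, hren' j hj, (hslots' j hj).1⟩, (hslots' j hj).2.1.1, (hslots' j hj).2.1.2.1⟩
  exact (hyp K hK L M hL hM n hn hren).2.1.2.2 hM0 L' M' hLL' hM0' hante' θ

end Summit.HubbardSuperconductivity.HubbardSuperconductivity.Theorems.KLRegimeSplit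

end
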